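import Summits.SmoothPoincare4.SmoothPoincare4.Theses.SymplecticOrigami
import Literature.Geometry.Symplectic.SphereProdSymplecticHost
import Literature.Geometry.Manifold.CompactChartDomainEmbedding
import Literature.Topology.FourManifolds.HomotopySpheres
import Literature.Topology.FourManifolds.PuncturedHomotopySphere

/-!
# Line `stable-seam-host` (crux `OrigamiFoldExistence`, stmt-SmoothPoincare4-7844): STUB 1 holds for every homotopy 4-sphere diffeomorphic to `S⁴`; the shield `SPC4 ⇒ STUB 1`

Worker A certificates (wave 1 of lead c9).  With the host package now in the tree
(`Literature.Geometry.Symplectic.SphereProdFour`, `(S² × S², σ ⊕ σ)` charted on `ℝ⁴`;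
`helper_hostPackage_sphereProd`), the two kernel statements about the registered STUB 1
`stub_hostEmbedding` that were blocked on it are proved:

* `helper_hostEmbedding_of_diffeomorph_sphere` — STUB 1 for every homotopy 4-sphere `S` whose
  carrier is DIFFEOMORPHIC to the round `S⁴` (in particular its `S⁴`-instance): the fake ball
  `Δ_e = S ∖ e(B̊⁴)` is compact (the chart ball `e` is an open embedding, tree theorem
  `isOpenEmbedding_of_isSmoothEmbedding_euclidean`) and misses `e 0`, so it lies in ONE
  stereographic chart of `S⁴` and a neighbourhood of it embeds into the (non-empty) host
  (tree theorem `Literature.Geometry.Manifold.exists_nhd_embedding_of_isCompact_of_diffeomorph_sphere`);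
  the host data `Ω, c, c'` are those of `sphereProdFour_hostPackage`.
* `helper_hostEmbedding_of_smoothPoincare4` — the SHIELD: `SmoothPoincare4 →` STUB 1 (signature of
  `stub_hostEmbedding` verbatim as conclusion), since SPC4 makes every homotopy 4-sphere
  diffeomorphic to `S⁴`.  So STUB 1 is irrefutable short of an exotic 4-sphere, like STUB 3
  (`helper_stableSeamRigidity_of_smoothPoincare4`, p141078).

No definitions, no named facts, no `sorry`.
-/

noncomputable section

-- the prescribed namespace `Summit.<P>.<Sub>.…` duplicates `SmoothPoincare4` (P = Sub)
set_option linter.dupNamespace false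

open scoped Manifold ContDiff Topology
open Set Function

namespace Summit.SmoothPoincare4.SmoothPoincare4.Theorems.OrigamiFoldExistence.StableSeamHost

open Literature.Geometry.Symplectic

/-- A point of the round 2-sphere and its antipode are distinct: `q₀ ≠ -q₀`. [folklore] -/
private theorem northPole_ne_neg' :
    (⟨EuclideanSpace.single 0 1, by simp⟩ : Metric.sphere (0 : EuclideanSpace ℝ (Fin 3)) 1) ≠
      -⟨EuclideanSpace.single 0 1, by simp⟩ :=
  ne_neg_of_mem_unit_sphere ℝ _

/-- **STUB 1 (`stub_hostEmbedding`) holds for every homotopy 4-sphere diffeomorphic to `S⁴`**: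
given a chart ball `e` and a diffeomorphism `S ≅ S⁴`, the fake ball `(e(B̊⁴))ᶜ` is compact
(`e` is an open embedding) and misses `e 0`, hence sits in one stereographic chart and a
neighbourhood of it embeds in the host `(S² × S², σ ⊕ σ)` charted on `ℝ⁴`, which carries the
square-zero symplectic sphere pair `S² × {±q₀}`. [folklore] -/
theorem helper_hostEmbedding_of_diffeomorph_sphere :
    ∀ (S : Literature.Topology.FourManifolds.HomotopySphere 4) (e : EuclideanSpace ℝ (Fin 4) → S.carrier), Manifold.IsSmoothEmbedding (𝓡 4) (𝓡 4) ∞ e → Nonempty (S.carrier ≃ₘ⟮𝓡 4, 𝓡 4⟯ Metric.sphere (0 : EuclideanSpace ℝ (Fin 5)) 1) → ∃ (X : Type) (_ : TopologicalSpace X) (_ : T2Space X) (_ : SecondCountableTopology X) (_ : CompactSpace X) (_ : ChartedSpace (EuclideanSpace ℝ (Fin 4)) X) (_ : IsManifold (𝓡 4) ∞ X) (_ : SimplyConnectedSpace X) (Ω : Literature.Geometry.Kaehler.MForm (𝓡 4) X ℝ 2) (J : S.carrier → X) (c c' : (Metric.sphere (0 : EuclideanSpace ℝ (Fin 3)) 1)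 → X), (Literature.Geometry.Kaehler.IsSmoothForm Ω ∧ Literature.Geometry.Kaehler.IsClosedForm Ω ∧ ∀ x (v : TangentSpace (𝓡 4) x), v ≠ 0 → ∃ w, Ω x ![v, w] ≠ 0) ∧ (∃ U : Set S.carrier, IsOpen U ∧ (e '' Metric.ball (0 : EuclideanSpace ℝ (Fin 4)) 1)ᶜ ⊆ U ∧ ContMDiffOn (𝓡 4) (𝓡 4) ∞ J U ∧ Set.InjOn J U ∧ ∀ x ∈ U, Function.Bijective (mfderiv (𝓡 4) (𝓡 4) J x)) ∧ (Manifold.IsSmoothEmbedding (𝓡 2) (𝓡 4) ∞ c ∧ (∀ y (v : TangentSpace (𝓡 2) y), v ≠ 0 → ∃ w : TangentSpace (𝓡 2) y, Ω (c y) ![mfderiv (𝓡 2) (𝓡 4) c y v, mfderiv (𝓡 2) (𝓡 4) c y w] ≠ 0) ∧ Manifold.IsSmoothEmbedding (𝓡 2) (𝓡 4) ∞ c' ∧ Disjoint (Set.range c) (Set.range c') ∧ ∃ H : unitInterval × (Metric.sphere (0 : EuclideanSpace ℝ (Fin 3)) 1) → X, Continuous H ∧ ∀ y, H (0, y) = c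 y ∧ H (1, y) = c' y) := by
  intro S e he hΨ
  obtain ⟨Ψ⟩ := hΨ
  haveI : Fact (Module.finrank ℝ (EuclideanSpace ℝ (Fin 5)) = 4 + 1) := ⟨finrank_euclideanSpace_fin⟩
  -- the chart ball is an open embedding, so the fake ball is compact and misses `e 0`
  have heo : Topology.IsOpenEmbedding e :=
    Literature.Topology.FourManifolds.isOpenEmbedding_of_isSmoothEmbedding_euclidean he
  have hFc : IsCompact (e '' Metric.ball (0 : EuclideanSpace ℝ (Fin 4)) 1)ᶜ :=
    (heo.isOpenMap _ Metric.isOpen_ball).isClosed_compl.isCompact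
  have hpF : e 0 ∉ (e '' Metric.ball (0 : EuclideanSpace ℝ (Fin 4)) 1)ᶜ :=
    fun h => h ⟨0, Metric.mem_ball_self one_pos, rfl⟩
  -- a neighbourhood of the fake ball embeds into the (non-empty) host
  haveI : Nonempty SphereProdFour := ⟨sphereProdFourDiffeo.symm
    (⟨EuclideanSpace.single 0 1, by simp⟩, ⟨EuclideanSpace.single 0 1, by simp⟩)⟩
  obtain ⟨U, J, hUo, hFU, hJ, hJi, hJd⟩ :=
    Literature.Geometry.Manifold.exists_nhd_embedding_of_isCompact_of_diffeomorph_sphere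
      (X := SphereProdFour) Ψ hFc hpF
  have hP := sphereProdFour_hostPackage northPole_ne_neg'
  exact ⟨SphereProdFour, inferInstance, inferInstance, inferInstance, inferInstance, inferInstance,
    inferInstance, inferInstance, sphereProdFourForm, J, sphereProdFourSlice _, sphereProdFourSlice _,
    hP.1, ⟨U, hUo, hFU, hJ, hJi, hJd⟩, hP.2⟩

/-- **The shield of STUB 1: `SmoothPoincare4 ⇒ stub_hostEmbedding`** (signature of the registered
stub verbatim as conclusion).  Under SPC4 every homotopy 4-sphere is diffeomorphic to `S⁴`
(Mathlib's `ContinuousMap.HomotopyEquiv.NonemptyDiffeomorphSphere _ 4`), and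
`helper_hostEmbedding_of_diffeomorph_sphere` applies.  Hence no counterexample to STUB 1 exists
short of an exotic 4-sphere. [folklore] -/
theorem helper_hostEmbedding_of_smoothPoincare4 :
    _root_.SmoothPoincare4 → ∀ (S : Literature.Topology.FourManifolds.HomotopySphere 4) (e : EuclideanSpace ℝ (Fin 4) → S.carrier), Manifold.IsSmoothEmbedding (𝓡 4) (𝓡 4) ∞ e → ∃ (X : Type) (_ : TopologicalSpace X) (_ : T2Space X) (_ : SecondCountableTopology X) (_ : CompactSpace X) (_ : ChartedSpace (EuclideanSpace ℝ (Fin 4)) X) (_ : IsManifold (𝓡 4) ∞ X) (_ : SimplyConnectedSpace X) (Ω : Literature.Geometry.Kaehler.MForm (𝓡 4) X ℝ 2) (J : S.carrier → X) (c c' : (Metric.sphere (0 : EuclideanSpace ℝ (Fin 3)) 1) → X), (Literature.Geometry.Kaehler.IsSmoothForm Ω ∧ Literature.Geometry.Kaehler.IsClosedForm Ω ∧ ∀ x (v : TangentSpace (𝓡 4) x), v ≠ 0 → ∃ w, Ω x ![v, w] ≠ 0) ∧ (∃ U : Set S.carrier, IsOpen U ∧ (e '' Metric.ball (0 : EuclideanSpace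 ℝ (Fin 4)) 1)ᶜ ⊆ U ∧ ContMDiffOn (𝓡 4) (𝓡 4) ∞ J U ∧ Set.InjOn J U ∧ ∀ x ∈ U, Function.Bijective (mfderiv (𝓡 4) (𝓡 4) J x)) ∧ (Manifold.IsSmoothEmbedding (𝓡 2) (𝓡 4) ∞ c ∧ (∀ y (v : TangentSpace (𝓡 2) y), v ≠ 0 → ∃ w : TangentSpace (𝓡 2) y, Ω (c y) ![mfderiv (𝓡 2) (𝓡 4) c y v, mfderiv (𝓡 2) (𝓡 4) c y w] ≠ 0) ∧ Manifold.IsSmoothEmbedding (𝓡 2) (𝓡 4) ∞ c' ∧ Disjoint (Set.range c) (Set.range c') ∧ ∃ H : unitInterval × (Metric.sphere (0 : EuclideanSpace ℝ (Fin 3)) 1) → X, Continuous H ∧ ∀ y, H (0, y) = c y ∧ H (1, y) = c' y) := by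
  intro hSPC S e he
  unfold _root_.SmoothPoincare4 Literature.SPC4.SmoothPoincareConjectureFour
    ContinuousMap.HomotopyEquiv.NonemptyDiffeomorphSphere at hSPC
  obtain ⟨hM⟩ := S.nonempty_homotopyEquiv
  exact helper_hostEmbedding_of_diffeomorph_sphere S e he (hSPC S.carrier inferInstance inferInstance hM)

end Summit.SmoothPoincare4.SmoothPoincare4.Theorems.OrigamiFoldExistence.StableSeamHost

end
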